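import Mathlib
import Summits.Ventures.PercRepro2.A3InactiveTyped
import Summits.Ventures.PercRepro2.CutVertexDefs

/-!
# Two-copy counts factorise across a cut vertex
(blind cell PercRepro2, mine-c g15, 2026-08-25; `conjectures/MINE-C.md` §24, `proofs/MINEC-TB14BLOCK.md`)

At a cut vertex `x` with edge sides `EA`, `EB` (`CutV.IsCut`), a first copy `y` splits into its side
restrictions `restrict EA y`, `restrict EB y`, and the second copy `flipOn F y` splits the same way
(`restrict_flipOn`: the complement on the free edges commutes with the side restriction).  Hence a
two-copy count of a PRODUCT `f · g`, with `f` read on the side `EA` and `g` on the side `EB`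
(`SideFn`), is the product of the two side counts at the side profiles (`sideFree`, `restrict` of the
pinning): **`pairCount_mul_of_cut`** — the product law of the domain Markov property in the
Bernstein-coefficient (profile-wise) vocabulary.  This is the bookkeeping behind the cut-vertex
reduction of typed BHK 1.4 (`TB14CutCase1` …).  Own work; standard axioms.
-/

namespace Summit.Ventures.PercRepro2

namespace TB14Cut

open CovForm A3InactiveTyped CutV

/-! ## Side profiles -/

section Side

variable {E : Type*}

/-- The free edges of the profile on the side `S`. -/
def sideFree (S : Set E) [DecidablePred (· ∈ S)] (F : Finset E) : Finset E := F.filter (· ∈ S)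

/-- Membership in the side free set. -/
lemma mem_sideFree {S : Set E} [DecidablePred (· ∈ S)] {F : Finset E} {e : E} :
    e ∈ sideFree S F ↔ e ∈ F ∧ e ∈ S := Finset.mem_filter

/-- A side restriction is admissible for the side profile iff the configuration agrees with the
pinning on the pinned edges of that side. -/
lemma side_admissible_iff (S : Set E) [DecidablePred (· ∈ S)] (F : Finset E) (z y : Config E) :
    (∀ e, e ∉ sideFree S F → restrict S y e = restrict S z e) ↔
      (∀ e, e ∈ S → e ∉ F → y e = z e) := by
  constructor
  · intro h e heS heF
    have := h e (fun h' => heF (mem_sideFree.1 h').1)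
    rwa [restrict_apply_of_mem heS, restrict_apply_of_mem heS] at this
  · intro h e he
    by_cases heS : e ∈ S
    · rw [restrict_apply_of_mem heS, restrict_apply_of_mem heS]
      exact h e heS (fun heF => he (mem_sideFree.2 ⟨heF, heS⟩))
    · rw [restrict_apply_of_notMem heS, restrict_apply_of_notMem heS]

variable [DecidableEq E]

/-- The complement on the free edges commutes with the side restriction: the second copy of the
side restriction is the side restriction of the second copy. -/
lemma restrict_flipOn (S : Set E) [DecidablePred (· ∈ S)] (F : Finset E) (y : Config E) :
    restrict S (A3InactiveTyped.flipOn F y) =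
      A3InactiveTyped.flipOn (sideFree S F) (restrict S y) := by
  funext e
  by_cases heS : e ∈ S
  · by_cases heF : e ∈ F
    · have h : e ∈ sideFree S F := mem_sideFree.2 ⟨heF, heS⟩
      rw [restrict_apply_of_mem heS, A3InactiveTyped.flipOn_of_mem heF,
        A3InactiveTyped.flipOn_of_mem h, restrict_apply_of_mem heS]
    · have h : e ∉ sideFree S F := fun h' => heF (mem_sideFree.1 h').1
      rw [restrict_apply_of_mem heS, A3InactiveTyped.flipOn_of_notMem heF,
        A3InactiveTyped.flipOn_of_notMem h, restrict_apply_of_mem heS]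
  · have h : e ∉ sideFree S F := fun h' => heS (mem_sideFree.1 h').2
    rw [restrict_apply_of_notMem heS, A3InactiveTyped.flipOn_of_notMem h,
      restrict_apply_of_notMem heS]

end Side

/-! ## The cut -/

section Cut

variable {V : Type*} {E : Type*} [DecidableEq E] {ends : E → Sym2 V} {x : V} {VA VB : Set V}
  {EA EB : Set E} [DecidablePred (· ∈ EA)] [DecidablePred (· ∈ EB)]

omit [DecidableEq E] [DecidablePred (· ∈ EA)] [DecidablePred (· ∈ EB)] in
/-- The `B`-edges are exactly the edges off `EA`. -/
lemma mem_EB_iff (h : IsCut ends x VA VB EA EB) (e : E) : e ∈ EB ↔ e ∉ EA := by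
  constructor
  · intro heB heA
    exact Set.disjoint_left.1 h.Edisj heA heB
  · intro heA
    rcases h.cover e with h' | h'
    · exact absurd h' heA
    · exact h'

omit [DecidableEq E] in
/-- Admissibility for the profile is the conjunction of the two side admissibilities. -/
lemma admissible_iff_sides (h : IsCut ends x VA VB EA EB) (F : Finset E) (z y : Config E) :
    (∀ e, e ∉ F → y e = z e) ↔
      ((∀ e, e ∉ sideFree EA F → restrict EA y e = restrict EA z e) ∧
        (∀ e, e ∉ sideFree EB F → restrict EB y e = restrict EB z e)) := by
  rw [side_admissible_iff, side_admissible_iff]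
  constructor
  · intro hy
    exact ⟨fun e _ heF => hy e heF, fun e _ heF => hy e heF⟩
  · rintro ⟨hA, hB⟩ e heF
    rcases h.cover e with heA | heB
    · exact hA e heA heF
    · exact hB e heB heF

omit [DecidableEq E] in
/-- The `A`-restriction of a glued configuration keeps the `A`-part and closes the rest. -/
lemma restrict_EA_glue (σ₁ : {e // e ∈ EA} → Bool) (σ₂ : {e // e ∉ EA} → Bool) :
    restrict EA (glue EA σ₁ σ₂) = glue EA σ₁ (fun _ => false) := by
  funext e
  by_cases he : e ∈ EA
  · rw [restrict_apply_of_mem he, glue_apply_of_mem EA σ₁ σ₂ he, glue_apply_of_mem EA σ₁ _ he]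
  · rw [restrict_apply_of_notMem he, glue_apply_of_notMem EA σ₁ _ he]

omit [DecidableEq E] in
/-- The `B`-restriction of a glued configuration keeps the `B`-part and closes the rest. -/
lemma restrict_EB_glue (h : IsCut ends x VA VB EA EB) (σ₁ : {e // e ∈ EA} → Bool)
    (σ₂ : {e // e ∉ EA} → Bool) :
    restrict EB (glue EA σ₁ σ₂) = glue EA (fun _ => false) σ₂ := by
  funext e
  by_cases he : e ∈ EA
  · have : e ∉ EB := fun h' => (mem_EB_iff h e).1 h' he
    rw [restrict_apply_of_notMem this, glue_apply_of_mem EA _ σ₂ he]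
  · have : e ∈ EB := (mem_EB_iff h e).2 he
    rw [restrict_apply_of_mem this, glue_apply_of_notMem EA σ₁ σ₂ he,
      glue_apply_of_notMem EA _ σ₂ he]

variable {R : Type*} [CommRing R]

variable [Fintype E]

/-- The side count as a sum over the side's own configurations: the configurations admissible for
the side profile vanish off the side, so the sum over the complement collapses. -/
lemma pairCount_side_eq_sum (F : Finset E) (z : Config E) (f : Config E → Config E → R) :
    pairCount (sideFree EA F) (restrict EA z) f =
      ∑ σ₁ : {e // e ∈ EA} → Bool,
        (if (∀ e, e ∉ sideFree EA F → glue EA σ₁ (fun _ => false) e = restrict EA z e) then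
          f (glue EA σ₁ (fun _ => false))
            (A3InactiveTyped.flipOn (sideFree EA F) (glue EA σ₁ (fun _ => false))) else 0) := by
  unfold pairCount
  rw [sum_glue EA]
  refine Finset.sum_congr rfl fun σ₁ _ => ?_
  rw [Finset.sum_eq_single (fun _ => false)]
  · intro σ₂ _ hσ₂
    rw [if_neg]
    intro hadm
    apply hσ₂
    funext e
    have he : (e : E) ∉ sideFree EA F := fun h' => e.2 (mem_sideFree.1 h').2
    have := hadm e he
    rwa [glue_apply_of_notMem EA σ₁ σ₂ e.2, restrict_apply_of_notMem e.2] at this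
  · intro habs
    exact absurd (Finset.mem_univ _) habs

/-- The `B`-side count as a sum over the `B`-side configurations (glued with the closed `A`-side). -/
lemma pairCount_sideB_eq_sum (h : IsCut ends x VA VB EA EB) (F : Finset E) (z : Config E)
    (g : Config E → Config E → R) :
    pairCount (sideFree EB F) (restrict EB z) g =
      ∑ σ₂ : {e // e ∉ EA} → Bool,
        (if (∀ e, e ∉ sideFree EB F → glue EA (fun _ => false) σ₂ e = restrict EB z e) then
          g (glue EA (fun _ => false) σ₂)
            (A3InactiveTyped.flipOn (sideFree EB F) (glue EA (fun _ => false) σ₂)) else 0) := by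
  unfold pairCount
  rw [sum_glue EA, Finset.sum_comm]
  refine Finset.sum_congr rfl fun σ₂ _ => ?_
  rw [Finset.sum_eq_single (fun _ => false)]
  · intro σ₁ _ hσ₁
    rw [if_neg]
    intro hadm
    apply hσ₁
    funext e
    have heB : (e : E) ∉ EB := fun h' => (mem_EB_iff h e).1 h' e.2
    have he : (e : E) ∉ sideFree EB F := fun h' => heB (mem_sideFree.1 h').2
    have := hadm e he
    rwa [glue_apply_of_mem EA σ₁ σ₂ e.2, restrict_apply_of_notMem heB] at this
  · intro habs
    exact absurd (Finset.mem_univ _) habs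

/-- **Product law for two-copy counts across a cut**: a kernel `f · g` with `f` read on the side
`EA` and `g` on the side `EB` has two-copy count the product of the two side counts at the side
profiles `(sideFree EA F, restrict EA z)` and `(sideFree EB F, restrict EB z)`. -/
theorem pairCount_mul_of_cut (h : IsCut ends x VA VB EA EB) (F : Finset E) (z : Config E)
    (f g : Config E → Config E → R) (hf : ∀ y w, f y w = f (restrict EA y) (restrict EA w))
    (hg : ∀ y w, g y w = g (restrict EB y) (restrict EB w)) :
    pairCount F z (fun y w => f y w * g y w) =
      pairCount (sideFree EA F) (restrict EA z) f * pairCount (sideFree EB F) (restrict EB z) g := by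
  -- the two side kernels as functions of a side configuration
  set ΦA : Config E → R := fun u =>
    if (∀ e, e ∉ sideFree EA F → u e = restrict EA z e) then
      f u (A3InactiveTyped.flipOn (sideFree EA F) u) else 0 with hΦA
  set ΦB : Config E → R := fun v =>
    if (∀ e, e ∉ sideFree EB F → v e = restrict EB z e) then
      g v (A3InactiveTyped.flipOn (sideFree EB F) v) else 0 with hΦB
  have hL : pairCount F z (fun y w => f y w * g y w) =
      ∑ y : Config E, ΦA (restrict EA y) * ΦB (restrict EB y) := by
    unfold pairCount
    refine Finset.sum_congr rfl fun y _ => ?_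
    simp only [hΦA, hΦB]
    by_cases hadm : ∀ e, e ∉ F → y e = z e
    · obtain ⟨hA, hB⟩ := (admissible_iff_sides h F z y).1 hadm
      rw [if_pos hadm, if_pos hA, if_pos hB, hf y, hg y, restrict_flipOn, restrict_flipOn]
    · rw [if_neg hadm]
      by_cases hA : ∀ e, e ∉ sideFree EA F → restrict EA y e = restrict EA z e
      · have hB : ¬ ∀ e, e ∉ sideFree EB F → restrict EB y e = restrict EB z e :=
          fun hB => hadm ((admissible_iff_sides h F z y).2 ⟨hA, hB⟩)
        rw [if_neg hB, mul_zero]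
      · rw [if_neg hA, zero_mul]
  have hA' : pairCount (sideFree EA F) (restrict EA z) f =
      ∑ σ₁ : {e // e ∈ EA} → Bool, ΦA (glue EA σ₁ (fun _ => false)) :=
    pairCount_side_eq_sum F z f
  have hB' : pairCount (sideFree EB F) (restrict EB z) g =
      ∑ σ₂ : {e // e ∉ EA} → Bool, ΦB (glue EA (fun _ => false) σ₂) :=
    pairCount_sideB_eq_sum h F z g
  rw [hL, hA', hB', Finset.sum_mul_sum,
    sum_glue EA (fun y => ΦA (restrict EA y) * ΦB (restrict EB y))]
  refine Finset.sum_congr rfl fun σ₁ _ => Finset.sum_congr rfl fun σ₂ _ => ?_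
  rw [restrict_EA_glue, restrict_EB_glue h]

end Cut

end TB14Cut

end Summit.Ventures.PercRepro2
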